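import Summits.NavierStokesRegularity.NavierStokesRegularity.Theorems.FilamentSkeletonRssCoreLinearInvertibilityClassClosureToolsB
import Summits.AnomalousDissipation.AnomalousDissipation.Theorems.MarginalStabilityChainStretchedVortexRowsStubCoreInverseIntegrabilityTools

/-!
# Tools for stub `stub_classClosure` (crux `CoreLinearInvertibility`, stmt-NavierStokesRegularity-17973,
# route `FilamentSkeletonRss`, line `Sketch`) — part C: moment correction

The cut-offs `χ_k w` of a zero-moment vorticity lose the three moment conditions
`∫ v = ∫ x₀ v = ∫ x₁ v = 0`; they are restored by subtracting multiples of three fixed test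
functions with moment matrix the identity, built from the even bump `φ = dyadicCutoff ℝ²`
(`I = ∫ φ > 0`, `∫ xⱼ φ = 0` by oddness) and its two unit translates `φ(· − eᵢ)`
(`∫ xⱼ φ(· − eᵢ) = δᵢⱼ I`, translation invariance):
`η₀ = φ/I` (moments `(1,0,0)`), `ηᵢ₊₁ = (φ(· − eᵢ) − φ)/I` (moments `(0, δᵢ₀, δᵢ₁)`).
Also: the moments of `χ_k f` converge to those of `f` (dominated convergence), and for a `C²_c`
test function `η` the image `T_{λ,R} η` lies in `X_λ` (local part `C_c`, nonlocal part by the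
Young-type bound of part B).

References: folklore.
-/

set_option linter.dupNamespace false

noncomputable section

namespace Summit.NavierStokesRegularity.NavierStokesRegularity.Theorems

open Set Function Filter MeasureTheory Topology
open Literature.Analysis Literature.Analysis.FluidPDE
open Summit.AnomalousDissipation.AnomalousDissipation.Theorems.MarginalStabilityChainStretchedVortexRows
open scoped InnerProductSpace Laplacian ContDiff

/-! ### Moments of the bump and of its translates -/

section Bump

variable {φ : EuclideanSpace ℝ (Fin 2) → ℝ}

/-- A continuous compactly supported function times a coordinate is integrable. [folklore] -/
theorem integrable_coord_mul_of_hasCompactSupport (hφ : Continuous φ) (hφc : HasCompactSupport φ)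
    (j : Fin 2) : Integrable (fun x : EuclideanSpace ℝ (Fin 2) => x j * φ x) :=
  ((PiLp.continuous_apply 2 _ j).mul hφ).integrable_of_hasCompactSupport hφc.mul_left

/-- **First moments of an even function vanish**: `∫ xⱼ φ = 0` if `φ(−x) = φ(x)`. [folklore] -/
theorem integral_coord_mul_eq_zero_of_even (heven : ∀ x, φ (-x) = φ x) (j : Fin 2) :
    ∫ x : EuclideanSpace ℝ (Fin 2), x j * φ x = 0 := by
  have h := integral_neg_eq_self (fun x : EuclideanSpace ℝ (Fin 2) => x j * φ x) volume
  simp only [PiLp.neg_apply, heven, neg_mul, integral_neg] at h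
  linarith

/-- Mass of a translate: `∫ φ(· − e) = ∫ φ`. [folklore] -/
theorem integral_comp_sub_eq (e : EuclideanSpace ℝ (Fin 2)) :
    ∫ x : EuclideanSpace ℝ (Fin 2), φ (x - e) = ∫ x, φ x :=
  integral_sub_right_eq_self φ e

/-- **First moments of a translate of an even function**: `∫ xⱼ φ(x − e) dx = eⱼ ∫ φ`. [folklore] -/
theorem integral_coord_mul_comp_sub (hφ : Continuous φ) (hφc : HasCompactSupport φ)
    (heven : ∀ x, φ (-x) = φ x) (e : EuclideanSpace ℝ (Fin 2)) (j : Fin 2) :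
    ∫ x : EuclideanSpace ℝ (Fin 2), x j * φ (x - e) = e j * ∫ x, φ x := by
  have h1 : (fun x : EuclideanSpace ℝ (Fin 2) => x j * φ (x - e)) =
      fun x => (fun y : EuclideanSpace ℝ (Fin 2) => (y j + e j) * φ y) (x - e) := by
    funext x
    simp
  rw [h1, integral_sub_right_eq_self (fun y : EuclideanSpace ℝ (Fin 2) => (y j + e j) * φ y) e]
  simp_rw [add_mul]
  rw [integral_add (integrable_coord_mul_of_hasCompactSupport hφ hφc j)
    ((hφ.integrable_of_hasCompactSupport hφc).const_mul _),
    integral_coord_mul_eq_zero_of_even heven, integral_const_mul, zero_add]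

end Bump

/-! ### The three moment-correction functions -/

section Eta

variable {φ : EuclideanSpace ℝ (Fin 2) → ℝ} (hφ : Continuous φ) (hφc : HasCompactSupport φ)
  (heven : ∀ x, φ (-x) = φ x) (hI : 0 < ∫ x, φ x)
include hφ hφc heven hI

omit hφ hφc in
/-- Moments of `η₀ = φ/I`: `(1, 0, 0)`. [folklore] -/
theorem moments_eta0 :
    ∫ x, (∫ y, φ y)⁻¹ * φ x = 1 ∧
      ∀ j : Fin 2, ∫ x : EuclideanSpace ℝ (Fin 2), x j * ((∫ y, φ y)⁻¹ * φ x) = 0 := by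
  refine ⟨?_, fun j => ?_⟩
  · rw [integral_const_mul, inv_mul_cancel₀ hI.ne']
  · have : (fun x : EuclideanSpace ℝ (Fin 2) => x j * ((∫ y, φ y)⁻¹ * φ x)) =
        fun x => (∫ y, φ y)⁻¹ * (x j * φ x) := by
      funext x; ring
    rw [this, integral_const_mul, integral_coord_mul_eq_zero_of_even heven, mul_zero]

/-- Moments of `ηᵢ₊₁ = (φ(· − eᵢ) − φ)/I`: `(0, δᵢ₀, δᵢ₁)`. [folklore] -/
theorem moments_etaT (i : Fin 2) :
    ∫ x, (∫ y, φ y)⁻¹ * (φ (x - EuclideanSpace.single i 1) - φ x) = 0 ∧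
      ∀ j : Fin 2, ∫ x : EuclideanSpace ℝ (Fin 2),
        x j * ((∫ y, φ y)⁻¹ * (φ (x - EuclideanSpace.single i 1) - φ x)) =
          (EuclideanSpace.single i (1 : ℝ)) j := by
  have hφi : Integrable φ := hφ.integrable_of_hasCompactSupport hφc
  have hφti : Integrable (fun x => φ (x - EuclideanSpace.single i 1)) :=
    hφi.comp_sub_right (EuclideanSpace.single i 1)
  refine ⟨?_, fun j => ?_⟩
  · rw [integral_const_mul, integral_sub hφti hφi, integral_comp_sub_eq, sub_self, mul_zero]
  · have : (fun x : EuclideanSpace ℝ (Fin 2) =>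
        x j * ((∫ y, φ y)⁻¹ * (φ (x - EuclideanSpace.single i 1) - φ x))) =
        fun x => (∫ y, φ y)⁻¹ * (x j * φ (x - EuclideanSpace.single i 1) - x j * φ x) := by
      funext x; ring
    have hti : Integrable (fun x : EuclideanSpace ℝ (Fin 2) => x j * φ (x - EuclideanSpace.single i 1)) := by
      have hc : HasCompactSupport (fun x : EuclideanSpace ℝ (Fin 2) => φ (x - EuclideanSpace.single i 1)) :=
        hφc.comp_homeomorph (Homeomorph.subRight (EuclideanSpace.single i (1 : ℝ)))
      exact integrable_coord_mul_of_hasCompactSupport (hφ.comp (continuous_sub_right _)) hc j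
    rw [this, integral_const_mul, integral_sub hti (integrable_coord_mul_of_hasCompactSupport hφ hφc j),
      integral_coord_mul_comp_sub hφ hφc heven, integral_coord_mul_eq_zero_of_even heven, sub_zero,
      ← mul_assoc, mul_comm ((∫ y, φ y)⁻¹), mul_assoc, inv_mul_cancel₀ hI.ne', mul_one]

end Eta

/-! ### Moments of a corrected function; convergence of the moments of the cut-offs -/

/-- Moments are linear: `∫ q (u − m₀η₀ − m₁η₁ − m₂η₂) = ∫ q u − m₀∫ q η₀ − m₁∫ q η₁ − m₂∫ q η₂`.
[folklore] -/
theorem integral_mul_comb {q u η₀ η₁ η₂ : EuclideanSpace ℝ (Fin 2) → ℝ} (m₀ m₁ m₂ : ℝ)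
    (hu : Integrable (fun x => q x * u x)) (h0 : Integrable (fun x => q x * η₀ x))
    (h1 : Integrable (fun x => q x * η₁ x)) (h2 : Integrable (fun x => q x * η₂ x)) :
    ∫ x, q x * (u x - m₀ * η₀ x - m₁ * η₁ x - m₂ * η₂ x) =
      (∫ x, q x * u x) - m₀ * (∫ x, q x * η₀ x) - m₁ * (∫ x, q x * η₁ x) - m₂ * ∫ x, q x * η₂ x := by
  have heq : (fun x => q x * (u x - m₀ * η₀ x - m₁ * η₁ x - m₂ * η₂ x)) =
      fun x => q x * u x - m₀ * (q x * η₀ x) - m₁ * (q x * η₁ x) - m₂ * (q x * η₂ x) := by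
    funext x; ring
  have hA : Integrable (fun x => q x * u x - m₀ * (q x * η₀ x)) := hu.sub (h0.const_mul m₀)
  have hB : Integrable (fun x => q x * u x - m₀ * (q x * η₀ x) - m₁ * (q x * η₁ x)) :=
    hA.sub (h1.const_mul m₁)
  rw [heq, integral_sub hB (h2.const_mul m₂), integral_sub hA (h1.const_mul m₁),
    integral_sub hu (h0.const_mul m₀), integral_const_mul, integral_const_mul, integral_const_mul]

/-- **The moments of `χ_k f` converge to those of `f`** (`χ_k = cutoff (k+1) → 1` pointwise,
`|χ_k| ≤ 1`, dominated convergence). [folklore] -/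
theorem tendsto_integral_cutoff_mul {f : EuclideanSpace ℝ (Fin 2) → ℝ} (hf : Integrable f) :
    Tendsto (fun k : ℕ => ∫ x, cutoff ((k : ℝ) + 1) x * f x) atTop (𝓝 (∫ x, f x)) := by
  refine tendsto_integral_of_dominated_convergence (fun x => ‖f x‖)
    (fun k => ((contDiff_cutoff (n := 0) ((k : ℝ) + 1)).continuous.aestronglyMeasurable.mul
      hf.aestronglyMeasurable)) hf.norm (fun k => Eventually.of_forall fun x => ?_)
    (Eventually.of_forall fun x => ?_)
  · rw [norm_mul, Real.norm_eq_abs]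
    calc |cutoff ((k : ℝ) + 1) x| * ‖f x‖ ≤ 1 * ‖f x‖ :=
          mul_le_mul_of_nonneg_right (abs_cutoff_le_one _ _) (norm_nonneg _)
      _ = ‖f x‖ := one_mul _
  · simpa using (tendsto_cutoff_natCast_add_one x).mul_const (f x)

/-! ### `C²_c` test functions and their images under `T_{λ,R}` lie in `X_λ` -/

section MemX

variable {lam R : ℝ} {T : ℝ → ℝ → (EuclideanSpace ℝ (Fin 2) → ℝ) → EuclideanSpace ℝ (Fin 2) → ℝ}
  (hT : ∀ (lam R : ℝ) (w : EuclideanSpace ℝ (Fin 2) → ℝ) (x : EuclideanSpace ℝ (Fin 2)),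
    T lam R w x = strainedVorticityOperator lam w x -
      R * (⟪gaussVortexVelocity x, gradient w x⟫_ℝ + ⟪biotSavart2D w x, gradient gaussVortexProfile x⟫_ℝ))

/-- A continuous compactly supported function lies in `X_λ`. [folklore] -/
theorem integrable_inv_gaussWeightLam_mul_sq_of_hasCompactSupport (hlam : lam < 1)
    {η : EuclideanSpace ℝ (Fin 2) → ℝ} (hη : Continuous η) (hηc : HasCompactSupport η) :
    Integrable (fun x => (gaussWeightLam lam x)⁻¹ * η x ^ 2) :=
  ((continuous_inv_gaussWeightLam hlam).mul (hη.pow 2)).integrable_of_hasCompactSupport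
    (hηc.mono fun x hx => by
      rw [Function.mem_support] at hx ⊢
      exact fun h => hx (by simp [h]))

include hT

/-- **`T η ∈ X_λ` for `η ∈ C²_c`**: the local part `L_λη − R⟪v^G, ∇η⟫` is continuous with compact
support, and the nonlocal part `R⟪K∗η, ∇G⟫` lies in `X_λ` by the Young-type bound. [folklore] -/
theorem coreOp_memX (hlam : lam ∈ Set.Ico (0 : ℝ) 1) {η : EuclideanSpace ℝ (Fin 2) → ℝ}
    (hη : ContDiff ℝ 2 η) (hηc : HasCompactSupport η) :
    AEStronglyMeasurable (T lam R η) volume ∧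
      Integrable (fun x => (gaussWeightLam lam x)⁻¹ * T lam R η x ^ 2) := by
  obtain ⟨C, -, hY⟩ := exists_inv_gaussWeightLam_mul_inner_biotSavart2D_sq_le hlam
  have hηcont : Continuous η := hη.continuous
  have hηi : Integrable η := hηcont.integrable_of_hasCompactSupport hηc
  have hη2 : Integrable (fun x => η x ^ 2) :=
    (hηcont.pow 2).integrable_of_hasCompactSupport (hηc.mono fun x hx => by
      rw [Function.mem_support] at hx ⊢
      exact fun h => hx (by simp [h]))
  obtain ⟨hNi, -⟩ := hY η hηcont hηi hη2
  -- the local part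
  set ℓ : EuclideanSpace ℝ (Fin 2) → ℝ := fun x =>
    strainedVorticityOperator lam η x - R * ⟪gaussVortexVelocity x, gradient η x⟫_ℝ with hℓ
  have hℓc : Continuous ℓ := (continuous_strainedVorticityOperator hη lam).sub
    (continuous_const.mul (continuous_gaussVortexVelocity.inner
      (continuous_gradient_of_contDiff (hη.of_le one_le_two))))
  have hℓs : HasCompactSupport ℓ := by
    refine HasCompactSupport.intro hηc fun x hx => ?_
    simp only [hℓ, strainedVorticityOperator, laplacian_eq_zero_of_notMem_tsupport hx,
      fderiv_of_notMem_tsupport ℝ hx, image_eq_zero_of_notMem_tsupport hx,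
      gradient_eq_zero_of_notMem_tsupport hx]
    simp
  have hgl : Integrable (fun x => (gaussWeightLam lam x)⁻¹ * ℓ x ^ 2) :=
    integrable_inv_gaussWeightLam_mul_sq_of_hasCompactSupport hlam.2 hℓc hℓs
  have hTeq : T lam R η = fun x => ℓ x - R * ⟪biotSavart2D η x, gradient gaussVortexProfile x⟫_ℝ := by
    funext x
    rw [hT]
    simp only [hℓ]
    ring
  have hNm : AEStronglyMeasurable (fun x => ⟪biotSavart2D η x, gradient gaussVortexProfile x⟫_ℝ) volume :=
    (stronglyMeasurable_biotSavart2D hηcont.measurable).aestronglyMeasurable.inner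
      (continuous_gradient_of_contDiff (contDiff_gaussVortexProfile (n := 1))).aestronglyMeasurable
  have hmeas : AEStronglyMeasurable (T lam R η) volume := by
    rw [hTeq]
    exact hℓc.aestronglyMeasurable.sub (hNm.const_mul R)
  refine ⟨hmeas, ?_⟩
  have hg : ∀ x, 0 ≤ (gaussWeightLam lam x)⁻¹ := fun x => inv_nonneg.2 (gaussWeightLam_pos hlam.2 x).le
  refine Integrable.mono' ((hgl.const_mul 2).add ((hNi.const_mul (R ^ 2)).const_mul 2))
    ((continuous_inv_gaussWeightLam hlam.2).aestronglyMeasurable.mul (hmeas.pow 2))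
    (Eventually.of_forall fun x => ?_)
  rw [Real.norm_of_nonneg (mul_nonneg (hg x) (sq_nonneg _)), hTeq]
  change (gaussWeightLam lam x)⁻¹ * (ℓ x - R * ⟪biotSavart2D η x, gradient gaussVortexProfile x⟫_ℝ) ^ 2 ≤
    2 * ((gaussWeightLam lam x)⁻¹ * ℓ x ^ 2) +
      2 * (R ^ 2 * ((gaussWeightLam lam x)⁻¹ * ⟪biotSavart2D η x, gradient gaussVortexProfile x⟫_ℝ ^ 2))
  nlinarith [mul_nonneg (hg x) (sq_nonneg (ℓ x + R * ⟪biotSavart2D η x, gradient gaussVortexProfile x⟫_ℝ))]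

end MemX

/-- **Registered tools stub `stub_classClosureToolsD`** (helpers for `stub_classClosure`, line
`Sketch` of crux `CoreLinearInvertibility`, stmt-NavierStokesRegularity-17973): first moments of
even functions vanish, and the moments of the cut-offs `χ_k f` converge to those of `f`. [folklore] -/
theorem stub_classClosureToolsD :
    (∀ (φ : EuclideanSpace ℝ (Fin 2) → ℝ) (j : Fin 2), (∀ x, φ (-x) = φ x) →
      ∫ x : EuclideanSpace ℝ (Fin 2), x j * φ x = 0) ∧
    (∀ f : EuclideanSpace ℝ (Fin 2) → ℝ, Integrable f →
      Tendsto (fun k : ℕ => ∫ x, cutoff ((k : ℝ) + 1) x * f x) atTop (𝓝 (∫ x, f x))) :=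
  ⟨fun _ j heven => integral_coord_mul_eq_zero_of_even heven j, fun _ hf => tendsto_integral_cutoff_mul hf⟩

end Summit.NavierStokesRegularity.NavierStokesRegularity.Theorems
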